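import Summits.BirchSwinnertonDyer.BirchSwinnertonDyer.Theorems.EisensteinPrimesUnrSelmerQuotientTorsionFiniteChar
import Literature.NumberTheory.GaloisRepresentations.InertiaCohomologyTorsionBound
import Literature.NumberTheory.GaloisRepresentations.FrobeniusPrimeToPPart
import Literature.NumberTheory.EllipticCurves.KellerYin2024.CharacterModulePrufer
import Literature.NumberTheory.GaloisRepresentations.IntegralGaloisActionProofs
import Literature.NumberTheory.GaloisRepresentations.DecompositionGroupOfCompletion
import HarnessLib

/-!
# Local bounds at `v ∤ p` for `H¹(I_w(K_∞), (F/𝒪)(θ))`: `#(·)[p] ≤ p`, vanishing for `θ` ramified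
# at `v`, and vanishing of Frobenius-stable `p`-torsion classes when `θ(Frob_v) ≢ Nv (mod 𝔭)`
# (Keller–Yin / CGLS Lemma 1.1.1, UPPER-BOUND side, in the kernel)

Cell `bsd-eis` (home `run/shared/lean/pub/bsd-eis/`), seat `bsd-line-x1-p1-w2` (D-0154 width seat on
crux 2 `GoodLatticeBDPValue` = stmt-BirchSwinnertonDyer-19032, line `halves` v14, stub
`stub_imprimCorank`), step 3 of the unconditional `≤`-direction of the bare `S`-relaxation corank
identity `KellerYin2024.prop125_residualPair_unrSelmer_corank`: the PER-PLACE inputs `c_v` of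
`UnrSelmerQuotientCorankLeGeneric.zpCorank_quotient_le_sum` for Keller–Yin's character module
`M = (F/𝒪)(θ) = charModule ∅ θ` (`≅ ℚ_p/ℤ_p` with `Γ_K` acting through `θ`), at a place `v ∤ p` and
a subgroup `H ≤ Γ_K` containing the inertia group `I_v` (e.g. `H = ker κ` for a `ℤ_p`-extension):

* §1 `hom_apply_eq_zero_of_conj` — ABSTRACT (any non-archimedean local field `F`, any discrete
  `A` on which `I_F` acts trivially): a continuous homomorphism `f : I_F → A` killed by `p`,
  invariant under the prime-to-`p` part `g` of a Frobenius `φ` (`f(g⁻¹σg) = ρ(g)⁻¹ f(σ)`), vanishes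
  as soon as `g` acts on `A[p]` as an integer `a` with `p ∤ q_F − a`
  (`apply_conj_eq_card_nsmul_of_mapClusterPt`: `f(gσg⁻¹) = q f(σ)`).
* §2 `natCard_torsionBy_discreteH1_inertiaIn_le` — GENERIC `p`-divisible discrete `M` with
  finite `M[p]` and open stabilisers: `H¹(H ∩ I_v, M)[p]` is finite of order at most
  `#{m ∈ M[p] : I_{K_v} m = m}` (inflation `I_{K_v} ↠ H ∩ I_v` + the tree's
  `natCard_torsionBy_continuousCohomology_one_absInertia_le`, Milne ADT I.2.9 shape).
* §3 the CHARACTER module: `#H¹(H ∩ I_v, (F/𝒪)(θ))[p] ≤ p`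
  (`natCard_torsionBy_discreteH1_inertiaIn_charModule_le`), and `= 1` — no `p`-torsion — when `θ`
  is RAMIFIED at `v` and `θ^{p−1} = 1` (`torsionBy_discreteH1_inertiaIn_charModule_eq_bot_of_not_isUnramifiedAt`:
  a value `θ(σ) ≠ 1`, `σ ∈ I_v`, is a nontrivial `(p−1)`-st root of unity, hence `≢ 1 (mod p)`, and
  `I_v` fixes nothing in `M[p] ≅ ℤ/p`).
The Frobenius case for the character (`θ` unramified at `v`, `θ(Frob_v) ≢ Nv`) is assembled in the
sequel from §1.

HONEST FRAMING: tool theorems only (no definition, no named fact, no `sorry`); closes nothing by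
itself (`--supports stmt-BirchSwinnertonDyer-19032`); BSD / Mazur's main conjecture is proved for no curve.

References: Keller–Yin arXiv:2402.12781v2 Lemma 1.1.1 (TeX L455–462); Castella–Grossi–Lee–Skinner,
Invent. Math. 227 (2022) Lemma 1.1.1; Greenberg–Vatsal, Invent. Math. 142 (2000) §2 Prop. (2.4);
Greenberg, Adv. Stud. Pure Math. 17 (1989) §2 Prop. 2; Serre, *Local Fields* IV §2, XIII §1;
Serre, Invent. Math. 15 (1972) §1.8 Prop. 6; Milne, *ADT* I Lemma 2.9.
-/

-- `Summit.BirchSwinnertonDyer.BirchSwinnertonDyer.…`: summit and sub-problem share a name (D-0017 layout).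
set_option linter.dupNamespace false
set_option autoImplicit false

noncomputable section

open scoped Classical AddSubgroup Pointwise

open CategoryTheory Function Filter NumberField IsDedekindDomain Field ValuativeRel
open Literature.NumberTheory.EllipticCurves Literature.NumberTheory.EllipticCurves.GreenbergSelmer
  Literature.NumberTheory.GaloisRepresentations
  Literature.NumberTheory.GaloisRepresentations.IsNonarchimedeanLocalField
  Literature.NumberTheory.EllipticCurves.KellerYin2024
  Summit.BirchSwinnertonDyer.Rank1Residual

universe u

namespace Summit.BirchSwinnertonDyer.BirchSwinnertonDyer.Theorems.CharLocalInertiaBounds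

/-! ## §1 Abstract: Frobenius-stable `p`-torsion homomorphisms on inertia vanish when `p ∤ q − a` -/

section Abstract

variable (F : Type u) [Field F] [ValuativeRel F] [TopologicalSpace F] [IsNonarchimedeanLocalField F]
variable {A : Type u} [AddCommGroup A] [TopologicalSpace A] [DiscreteTopology A]

/-- **A `p`-torsion continuous homomorphism `f : I_F → A`, stable under the prime-to-`p` part `g` of
a Frobenius, VANISHES when `g` acts on `A[p]` as an integer `a` with `p ∤ q_F − a`.** Precisely: `ρ`
a continuous representation of `Γ_F` on the discrete `A`, `p` prime to the residue characteristic,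
`A[p]` finite; `φ` a Frobenius (`IsFrobPow φ 1`), `g` a cluster point of `φ^{p^{k!}}`
(`FrobeniusPrimeToPPart`), `ρ(g) d = a • d` on `A[p]`; `f : I_F → A` additive, continuous, `p f = 0`,
and `ρ(g) f(g⁻¹ σ g) = f(σ)` (e.g. `f` = a cocycle of a subgroup of `Γ_F` containing `I_F` and `g`,
restricted to `I_F` acting trivially). Then `f(g τ g⁻¹) = q • f(τ)` (Serre 1972 §1.8:
`apply_conj_eq_card_nsmul_of_mapClusterPt`) and `= ρ(g) f(τ) = a • f(τ)`, so `(q − a) f = 0 = p f`,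
`f = 0`. The trivial-inertia twin of b2b X2 `LocalInertiaTateQuotient.oneCocycleClass_eq_zero_of_conj`
(Greenberg–Vatsal Prop. (2.4), inertia side, case `d = 0`).
[cite: GreenbergVatsal2000, §2 Prop. (2.4) pp. 22–23] [cite: SerreInventiones1972, §1.8 Prop. 6] -/
theorem hom_apply_eq_zero_of_conj (ρ : ContinuousRep (absoluteGaloisGroup F) ℤ A) {p : ℕ}
    [hp : Fact p.Prime] (hpF : p.Coprime (ringChar 𝓀[F]))
    [Finite (Submodule.torsionBy ℤ A (p : ℤ))]
    {φ g : absoluteGaloisGroup F} (hφ : IsFrobPow φ 1)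
    (hg : MapClusterPt g atTop (fun k : ℕ => φ ^ p ^ k.factorial))
    (a : ℤ) (hga : ∀ d : A, (p : ℤ) • d = 0 → ρ g d = a • d)
    (hcong : ¬ ((p : ℤ) ∣ (residueFieldCard F : ℤ) - a))
    (f : absInertia F → A) (hf : ∀ x y, f (x * y) = f x + f y) (hfc : Continuous f)
    (hpf : ∀ σ, p • f σ = 0)
    (hinv : ∀ σ : absInertia F,
      ρ g (f ⟨g⁻¹ * (σ : absoluteGaloisGroup F) * g,
        (inferInstance : (absInertia F).Normal).conj_mem' _ σ.2 g⟩) = f σ)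
    (σ : absInertia F) : f σ = 0 := by
  -- `f` takes values in the finite group `A[p]`
  let fb : absInertia F → Submodule.torsionBy ℤ A (p : ℤ) := fun τ ↦
    ⟨f τ, by rw [Submodule.mem_torsionBy_iff, Nat.cast_smul_eq_nsmul]; exact hpf τ⟩
  have hfb : ∀ τ, ((fb τ : Submodule.torsionBy ℤ A (p : ℤ)) : A) = f τ := fun _ ↦ rfl
  have hfb_mul : ∀ x y, fb (x * y) = fb x + fb y := fun x y ↦ Subtype.ext (hf x y)
  have hfb_cont : Continuous fb := hfc.subtype_mk _
  -- the finite target is killed by `p`, hence of order prime to the residue characteristic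
  have hpB : ∀ d : Submodule.torsionBy ℤ A (p : ℤ), p • d = 0 := fun d ↦
    Subtype.ext (by
      rw [AddSubmonoidClass.coe_nsmul, ZeroMemClass.coe_zero, ← Nat.cast_smul_eq_nsmul ℤ]
      exact (Submodule.mem_torsionBy_iff _ _).1 d.2)
  have hB : (Nat.card (Submodule.torsionBy ℤ A (p : ℤ))).Coprime (ringChar 𝓀[F]) := by
    have hℓ : (ringChar 𝓀[F]).Prime := ringChar_residueField_prime (F := F)
    rw [Nat.Coprime, Nat.gcd_comm]
    refine Nat.coprime_of_dvd fun r hr hrℓ hrB ↦ ?_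
    have hr' : r = ringChar 𝓀[F] := (Nat.prime_dvd_prime_iff_eq hr hℓ).mp hrℓ
    haveI : Fact r.Prime := ⟨hr⟩
    obtain ⟨b, hb⟩ := exists_prime_addOrderOf_dvd_card' (G := Submodule.torsionBy ℤ A (p : ℤ)) r hrB
    have hdvd : r ∣ p := by rw [← hb]; exact addOrderOf_dvd_of_nsmul_eq_zero (hpB b)
    have hrp : r = p := (Nat.prime_dvd_prime_iff_eq hr hp.out).mp hdvd
    have h1 : p ∣ Nat.gcd p (ringChar 𝓀[F]) := Nat.dvd_gcd dvd_rfl (by rw [← hrp, hr'])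
    rw [hpF] at h1
    exact hp.out.one_lt.ne' (Nat.dvd_one.mp h1)
  -- (1) `f(g τ g⁻¹) = q • f(τ)`
  have hconj := apply_conj_eq_card_nsmul_of_mapClusterPt F hB hpB fb hfb_mul hfb_cont hφ hg
  -- (2) invariance at `g τ g⁻¹`: `f(g τ g⁻¹) = ρ(g) f(τ) = a • f(τ)`
  have hinv' : ∀ τ : absInertia F,
      f ⟨g * τ * g⁻¹, (inferInstance : (absInertia F).Normal).conj_mem _ τ.2 g⟩ = a • f τ := by
    intro τ
    have h := hinv ⟨g * τ * g⁻¹, (inferInstance : (absInertia F).Normal).conj_mem _ τ.2 g⟩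
    have hτ : (⟨g⁻¹ * (g * (τ : absoluteGaloisGroup F) * g⁻¹) * g,
        (inferInstance : (absInertia F).Normal).conj_mem' _
          ((inferInstance : (absInertia F).Normal).conj_mem _ τ.2 g) g⟩ : absInertia F) = τ :=
      Subtype.ext (by group)
    rw [hτ] at h
    rw [← h]
    exact hga _ (by rw [Nat.cast_smul_eq_nsmul]; exact hpf τ)
  -- (3) `(q − a) • f τ = 0 = p • f τ` with `p ∤ q − a`
  have hcop : IsCoprime ((residueFieldCard F : ℤ) - a) (p : ℤ) := by
    rw [Int.isCoprime_iff_gcd_eq_one]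
    rcases (Nat.dvd_prime hp.out).1 (Int.gcd_dvd_natAbs_right ((residueFieldCard F : ℤ) - a) (p : ℤ))
      with h | h
    · exact h
    · exfalso
      apply hcong
      have := Int.gcd_dvd_left ((residueFieldCard F : ℤ) - a) (p : ℤ)
      rw [h] at this
      exact this
  have hq : ((residueFieldCard F : ℕ) : ℤ) • f σ = a • f σ := by
    rw [← hinv' σ, Nat.cast_smul_eq_nsmul, ← hfb σ, ← AddSubmonoidClass.coe_nsmul, ← hconj σ]
  have hpx : (p : ℤ) • f σ = 0 := by rw [Nat.cast_smul_eq_nsmul]; exact hpf σ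
  have hqa : ((residueFieldCard F : ℤ) - a) • f σ = 0 := by rw [sub_smul, hq, sub_self]
  obtain ⟨u, w, huw⟩ := hcop
  calc f σ = (1 : ℤ) • f σ := (one_smul ℤ _).symm
    _ = (u * ((residueFieldCard F : ℤ) - a) + w * (p : ℤ)) • f σ := by rw [huw]
    _ = 0 := by rw [add_smul, mul_smul, mul_smul, hqa, hpx, zsmul_zero, zsmul_zero, add_zero]

end Abstract

/-! ## §2 Generic: `#H¹(H ∩ I_v, M)[p] ≤ #(M[p])^{I_{K_v}}` for a `p`-divisible discrete module -/

section Generic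

variable {K : Type u} [Field K] [NumberField K] {M : Type u} [AddCommGroup M]
  [DistribMulAction (absoluteGaloisGroup K) M] [TopologicalSpace M] [DiscreteTopology M]
  (p : ℕ) [hp : Fact p.Prime] (H : Subgroup (absoluteGaloisGroup K)) (v : HeightOneSpectrum (𝓞 K))

/-- **`H¹(H ∩ I_v, M)[p]` is finite of order `≤ #{m ∈ M[p] : I_{K_v} · m = m}`** for a discrete
`Γ_K`-module `M` with open stabilisers which is `p`-divisible with `M[p]` finite, a place `v ∤ p` and
`I_v ≤ H` (so `H ∩ I_v = I_v` is the image of the local inertia group `absInertia K_v`): inflation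
along `absInertia K_v ↠ H ∩ I_v` is injective on `H¹` (b2b `Iwasawa.resH1Hom_injective_of_surjective`)
and `#H¹(I_{K_v}, M)[p] ≤ #(M[p])^{I_{K_v}}` is the tree's
`natCard_torsionBy_continuousCohomology_one_absInertia_le` (Serre *Local Fields* IV §2 / XIII §1,
Milne ADT I.2.9). The inertia half of Greenberg's `H¹(K_{∞,η}, A) ≅ …` (1989, Prop. 2) in corank
currency, generic module. [cite: SerreLocalFields1979, Ch. IV §2 Cor. 1, Cor. 3 of Prop. 7 and Ch. XIII §1 Prop. 1]
[cite: MilneADT2006, I §2 Lemma 2.9] [cite: Greenberg1989, §2 Prop. 2] -/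
theorem natCard_torsionBy_discreteH1_inertiaIn_le [Finite (Submodule.torsionBy ℤ M (p : ℤ))]
    (hdiv : ∀ m : M, ∃ m' : M, p • m' = m)
    (hstab : ∀ m : M,
      IsOpen (MulAction.stabilizer (absoluteGaloisGroup K) m : Set (absoluteGaloisGroup K)))
    (hpv : (p : 𝓞 K) ∉ v.asIdeal) (hIH : inertia (K := K) v ≤ H) :
    Finite ((discreteH1 (inertiaIn H v) M)[(p : ℤ)]) ∧
      Nat.card ((discreteH1 (inertiaIn H v) M)[(p : ℤ)]) ≤
        Nat.card {m : Submodule.torsionBy ℤ M (p : ℤ) //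
          ∀ σ : absoluteGaloisGroup (v.adicCompletion K), σ ∈ absInertia (v.adicCompletion K) →
            absGaloisRestrict K (v.adicCompletion K) σ • (m : M) = m} := by
  -- the local action (through the chosen embedding), as a local instance of this proof only
  letI : DistribMulAction (absoluteGaloisGroup (v.adicCompletion K)) M :=
    DistribMulAction.compHom _ (absGaloisRestrict K (v.adicCompletion K)).toMonoidHom
  have hcont : ∀ m : M, Continuous fun σ : absoluteGaloisGroup K ↦ σ • m := fun m ↦
    continuous_smul_of_isOpen_stabilizer m (hstab m)
  -- `M` as a `ContinuousRep` of `Γ_{K_v}` over `ℤ`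
  let ρ : ContinuousRep (absoluteGaloisGroup (v.adicCompletion K)) ℤ M :=
    { toRepresentation :=
        (discreteContRep (absoluteGaloisGroup (v.adicCompletion K)) M).toRepresentation
      continuous_smul := by
        refine continuous_prod_of_discrete_right.mpr fun m ↦ ?_
        change Continuous fun σ : absoluteGaloisGroup (v.adicCompletion K) ↦
          absGaloisRestrict K (v.adicCompletion K) σ • m
        exact (hcont m).comp (absGaloisRestrict K (v.adicCompletion K)).continuous_toFun }
  have hbridge : (ρ.restrict (Literature.NumberTheory.GaloisRepresentations.subgroupIncl
      (absInertia (v.adicCompletion K)))).toTopRep =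
      discreteTopRep (absInertia (v.adicCompletion K)) M :=
    rfl
  -- the local bounds on `H¹(I_{K_v}, M)[p]`
  have hℓ := ringChar_residueField_prime (F := v.adicCompletion K)
  have hne := v.ringChar_residueField_adicCompletion_ne hpv
  have hcop : p.Coprime (ringChar 𝓀[v.adicCompletion K]) := (Nat.coprime_primes hp.out hℓ).2 (Ne.symm hne)
  have hfin := finite_torsionBy_continuousCohomology_one_absInertia (v.adicCompletion K) ρ hcop hdiv
  have hle := natCard_torsionBy_continuousCohomology_one_absInertia_le (v.adicCompletion K) ρ hcop hdiv
  rw [hbridge] at hfin hle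
  -- inflation along `absInertia K_v ↠ H ∩ I_v` is injective
  let θ : absInertia (v.adicCompletion K) →ₜ* inertiaIn H v :=
    { toFun := fun σ ↦ ⟨⟨absGaloisRestrict K (v.adicCompletion K) σ, ⟨σ, rfl⟩⟩,
        (mem_inertiaIn_iff H v _).2
          ⟨hIH (Subgroup.mem_map_of_mem _ σ.2), Subgroup.mem_map_of_mem _ σ.2⟩⟩
      map_one' := Subtype.ext (Subtype.ext (by simp))
      map_mul' := fun x y ↦ Subtype.ext (Subtype.ext (by simp))
      continuous_toFun := by
        refine Continuous.subtype_mk (Continuous.subtype_mk ?_ _) _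
        exact (absGaloisRestrict K (v.adicCompletion K)).continuous_toFun.comp
          continuous_subtype_val }
  have hθ : Function.Surjective θ := by
    intro x
    obtain ⟨σ, hσ, hσx⟩ := Subgroup.mem_map.1 ((mem_inertiaIn_iff H v x.1).1 x.2).2
    exact ⟨⟨σ, hσ⟩, Subtype.ext (Subtype.ext hσx)⟩
  have hinj := Iwasawa.resH1Hom_injective_of_surjective (M := M) θ hθ fun _ _ ↦ rfl
  set r := resH1Hom θ (AddMonoidHom.id M) (fun _ _ ↦ rfl) with hr
  -- `p`-torsion maps to `p`-torsion, injectively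
  let j : (discreteH1 (inertiaIn H v) M)[(p : ℤ)] →
      Submodule.torsionBy ℤ (discreteH1 (absInertia (v.adicCompletion K)) M) (p : ℤ) := fun y ↦
    ⟨r y, by
      rw [Submodule.mem_torsionBy_iff, Nat.cast_smul_eq_nsmul, ← map_nsmul,
        AddSubgroup.torsionBy.nsmul_iff.1 y.2, map_zero]⟩
  have hj : Function.Injective j := fun y z hyz ↦
    Subtype.ext (hinj (congrArg Subtype.val hyz))
  haveI := hfin
  exact ⟨Finite.of_injective j hj, (Nat.card_le_card_of_injective j hj).trans hle⟩

end Generic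

/-! ## §3 The character module `(F/𝒪)(θ)`: `#H¹(H ∩ I_v, M)[p] ≤ p`, and no `p`-torsion if `θ` ramifies -/

section CharModule

variable {K : Type} [Field K] [NumberField K] {p : ℕ} [hp : Fact p.Prime]
  (θ : FramedGaloisRep K (padicCoeffIntegers (∅ : Set (PadicAlgCl p))) 1)
  (H : Subgroup (absoluteGaloisGroup K)) (v : HeightOneSpectrum (𝓞 K))

omit [NumberField K] in
/-- `((F/𝒪)(θ))[p]` is finite, in the `Submodule.torsionBy` currency (`≅ (ℚ_p/ℤ_p)[p]`). [folklore] -/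
theorem finite_submoduleTorsionBy_charModule :
    Finite (Submodule.torsionBy ℤ (charModule (∅ : Set (PadicAlgCl p)) θ) (p : ℤ)) :=
  IwasawaTwoVariable.finite_torsionBy_charModule (p := p) θ

/-- **`#H¹(H ∩ I_v, (F/𝒪)(θ))[p] ≤ p`** (with finiteness) at a place `v ∤ p` with `I_v ≤ H`: §2 with
`#(M[p])^{I} ≤ #M[p] = p`. Hence every subgroup of `H¹(H ∩ I_v, (F/𝒪)(θ))` has `ℤ_p`-corank
`≤ 1` — the bound `λ(𝒫_w(θ)) ≤ [Γ : Γ_w]` per place of `K_∞` above `v` (KY Lemma 1.1.1,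
`charLocalLambda_le`). [cite: KellerYin2024, Lemma 1.1.1 (arXiv:2402.12781v2 TeX L455–462)]
[cite: GreenbergVatsal2000, §2 Prop. (2.4)] -/
theorem natCard_torsionBy_discreteH1_inertiaIn_charModule_le (hpv : (p : 𝓞 K) ∉ v.asIdeal)
    (hIH : inertia (K := K) v ≤ H) :
    Finite ((discreteH1 (inertiaIn H v) (charModule (∅ : Set (PadicAlgCl p)) θ))[(p : ℤ)]) ∧
      Nat.card ((discreteH1 (inertiaIn H v) (charModule (∅ : Set (PadicAlgCl p)) θ))[(p : ℤ)]) ≤ p := by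
  haveI := finite_submoduleTorsionBy_charModule θ
  obtain ⟨hfin, hle⟩ := natCard_torsionBy_discreteH1_inertiaIn_le p H v
    (M := charModule (∅ : Set (PadicAlgCl p)) θ)
    (UnrSelmerQuotientTorsionFiniteChar.exists_nsmul_eq_charModule θ)
    (GreenbergSelmer.isOpen_stabilizer_cofree (p := p) (∅ : Set (PadicAlgCl p)) θ) hpv hIH
  refine ⟨hfin, hle.trans ((Nat.card_le_card_of_injective _ Subtype.val_injective).trans ?_)⟩
  exact (UnrSelmerQuotientTorsionFiniteChar.natCard_torsionBy_charModule θ).le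

/-- **Roots of unity of order prime to `p` in `ℤ_p` are distinct modulo `p`**: `u^d = 1`, `p ∤ d`,
`u ≡ 1 (mod p)` force `u = 1` (`(1 + u + ⋯ + u^{d-1})(u − 1) = u^d − 1 = 0` and the first factor is
`≡ d ≢ 0`, a unit). Serre, *Local Fields* IV §4 (proof of Prop. 16: reduction is injective on
`μ_m`, `(m, p) = 1`). [folklore] -/
theorem padicInt_eq_one_of_pow_eq_one_of_sub_one_mem {u : ℤ_[p]} {d : ℕ} (hd : ¬ p ∣ d)
    (hu : u ^ d = 1) (h1 : u - 1 ∈ IsLocalRing.maximalIdeal ℤ_[p]) : u = 1 := by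
  have hprod : (∑ i ∈ Finset.range d, u ^ i) * (u - 1) = 0 := by rw [geom_sum_mul, hu, sub_self]
  have hubar : PadicInt.toZMod u = 1 := by
    rw [← PadicInt.ker_toZMod, RingHom.mem_ker, map_sub, map_one, sub_eq_zero] at h1
    exact h1
  have hsum : PadicInt.toZMod (∑ i ∈ Finset.range d, u ^ i) = (d : ZMod p) := by
    rw [map_sum]
    simp only [map_pow, hubar, one_pow, Finset.sum_const, Finset.card_range, nsmul_eq_mul, mul_one]
  have hunit : IsUnit (∑ i ∈ Finset.range d, u ^ i) := by
    by_contra hnu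
    have hmem : (∑ i ∈ Finset.range d, u ^ i) ∈ IsLocalRing.maximalIdeal ℤ_[p] := hnu
    rw [← PadicInt.ker_toZMod, RingHom.mem_ker, hsum, ZMod.natCast_eq_zero_iff] at hmem
    exact hd hmem
  exact sub_eq_zero.mp ((hunit.mul_right_eq_zero).mp hprod)

omit [NumberField K] in
/-- A rank-one framed `θ(σ) ≠ 1` has `unitChar θ σ ≠ 1` (the `1 × 1` matrix is its entry).
[cite: KellerYin2024, §1.1 (arXiv:2402.12781v2 TeX L441–449)] -/
theorem unitChar_ne_one_of_apply_ne_one {σ : absoluteGaloisGroup K} (h : θ σ ≠ 1) :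
    unitChar θ σ ≠ 1 := by
  intro h1
  apply h
  have hentry : ((θ σ : GL (Fin 1) (padicCoeffIntegers (∅ : Set (PadicAlgCl p)))) :
      Matrix (Fin 1) (Fin 1) (padicCoeffIntegers (∅ : Set (PadicAlgCl p)))) 0 0 = 1 := by
    rw [← padicIntEquiv_unitChar θ σ, h1, Units.val_one, map_one]
  refine Units.ext (Matrix.ext fun i j ↦ ?_)
  rw [Fin.fin_one_eq_zero i, Fin.fin_one_eq_zero j, hentry, Units.val_one, Matrix.one_apply_eq]

/-- **A character RAMIFIED at `v` moves something in `I_{K_v}`**: if `θ` is not unramified at `v`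
then some `σ` in the local inertia group `absInertia K_v` has `θ(res σ) ≠ 1` (the inertia groups
of the primes above `v` are the conjugates of `I_{𝔓₀} = res (I_{K_v})`,
`inertia_adicCompletionPrime_eq_map_absInertia`, `exists_smul_eq_of_mem_primesAbove_holds`).
[cite: SerreAbelianLadic1968, Ch. I §2.1] [cite: NeukirchANT1999, Ch. II §9 Prop. (9.6)] -/
theorem exists_mem_absInertia_apply_ne_one_of_not_isUnramifiedAt (hram : ¬ θ.IsUnramifiedAt v) :
    ∃ σ : absoluteGaloisGroup (v.adicCompletion K), σ ∈ absInertia (v.adicCompletion K) ∧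
      θ (absGaloisRestrict K (v.adicCompletion K) σ) ≠ 1 := by
  by_contra hall
  push Not at hall
  apply hram
  intro 𝔓 h𝔓 σ hσ
  obtain ⟨τ, rfl⟩ := HeightOneSpectrum.exists_smul_eq_of_mem_primesAbove_holds
    (adicCompletionPrime_mem_primesAbove K v) h𝔓
  -- `τ⁻¹ σ τ ∈ I_{𝔓₀} = res (I_{K_v})`
  have hσ' : τ⁻¹ * σ * τ ∈ (adicCompletionPrime K v).inertia (absoluteGaloisGroup K) := by
    intro x
    have hx : σ • τ • x - τ • x ∈ τ • adicCompletionPrime K v := hσ (τ • x)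
    rw [Ideal.mem_pointwise_smul_iff_inv_smul_mem, smul_sub] at hx
    simpa [mul_smul] using hx
  rw [inertia_adicCompletionPrime_eq_map_absInertia] at hσ'
  obtain ⟨σ', hσ'I, hσ'eq⟩ := Subgroup.mem_map.1 hσ'
  have h1 : θ (τ⁻¹ * σ * τ) = 1 := by
    rw [← hσ'eq]
    exact hall σ' hσ'I
  have e : σ = τ * (τ⁻¹ * σ * τ) * τ⁻¹ := by group
  rw [e, map_mul, map_mul, h1, mul_one, ← map_mul, mul_inv_cancel, map_one]

/-- **If `θ` (with `θ^{p−1} = 1`) is RAMIFIED at `v ∤ p`, then `H¹(H ∩ I_v, (F/𝒪)(θ))` has NO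
`p`-TORSION** (`I_v ≤ H`): a value `u = θ(σ) ≠ 1`, `σ ∈ I_{K_v}`, is a nontrivial `(p−1)`-st root of
unity in `ℤ_p`, hence `u ≢ 1 (mod p)` (`padicInt_eq_one_of_pow_eq_one_of_sub_one_mem`), so `I_{K_v}`
fixes no nonzero element of `M[p] ≅ ℤ/p` (`σ` acts by the unit `u`, `charModuleEquiv_galois_smul`)
and `#H¹(H ∩ I_v, M)[p] ≤ 1` by §2. The case "`θ` ramified at `w`, `F(θ)_{I_w} = 0`, `𝒫_w(θ) = 1`,
`λ(𝒫_w(θ)) = 0`" of KY Lemma 1.1.1 / GV Prop. (2.4) on the inertia side.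
[cite: KellerYin2024, Lemma 1.1.1 (arXiv:2402.12781v2 TeX L455–462)] [cite: GreenbergVatsal2000, §2 Prop. (2.4) p. 22] -/
theorem eq_zero_of_prime_nsmul_eq_zero_of_not_isUnramifiedAt
    (hθ : ∀ σ : absoluteGaloisGroup K, θ σ ^ (p - 1) = 1) (hpv : (p : 𝓞 K) ∉ v.asIdeal)
    (hIH : inertia (K := K) v ≤ H) (hram : ¬ θ.IsUnramifiedAt v)
    (y : discreteH1 (inertiaIn H v) (charModule (∅ : Set (PadicAlgCl p)) θ)) (hy : p • y = 0) :
    y = 0 := by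
  haveI := finite_submoduleTorsionBy_charModule θ
  obtain ⟨hfin, hle⟩ := natCard_torsionBy_discreteH1_inertiaIn_le p H v
    (M := charModule (∅ : Set (PadicAlgCl p)) θ)
    (UnrSelmerQuotientTorsionFiniteChar.exists_nsmul_eq_charModule θ)
    (GreenbergSelmer.isOpen_stabilizer_cofree (p := p) (∅ : Set (PadicAlgCl p)) θ) hpv hIH
  -- a ramified value `u = θ(σ) ≠ 1`, `u^{p-1} = 1`, hence `u - 1` is a unit of `ℤ_p`
  obtain ⟨σ, hσI, hσ⟩ := exists_mem_absInertia_apply_ne_one_of_not_isUnramifiedAt θ v hram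
  set u : ℤ_[p]ˣ := unitChar θ (absGaloisRestrict K (v.adicCompletion K) σ) with hu
  have hu1 : u ≠ 1 := unitChar_ne_one_of_apply_ne_one θ hσ
  have hup : (u : ℤ_[p]) ^ (p - 1) = 1 := by
    rw [← Units.val_pow_eq_pow_val, hu, unitChar_pow_eq_one θ hθ, Units.val_one]
  have hunit : IsUnit ((u : ℤ_[p]) - 1) := by
    by_contra hnu
    have hmem : (u : ℤ_[p]) - 1 ∈ IsLocalRing.maximalIdeal ℤ_[p] := hnu
    have hpd : ¬ p ∣ p - 1 := fun h ↦ by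
      have h2 := hp.out.two_le
      have := Nat.le_of_dvd (by omega) h
      omega
    exact hu1 (Units.ext (padicInt_eq_one_of_pow_eq_one_of_sub_one_mem hpd hup hmem))
  -- the inertia-fixed part of `M[p]` is trivial
  haveI hsub : Subsingleton {m : Submodule.torsionBy ℤ (charModule (∅ : Set (PadicAlgCl p)) θ) (p : ℤ) //
      ∀ τ : absoluteGaloisGroup (v.adicCompletion K), τ ∈ absInertia (v.adicCompletion K) →
        absGaloisRestrict K (v.adicCompletion K) τ • (m : charModule (∅ : Set (PadicAlgCl p)) θ) = m} := by
    refine ⟨fun a b ↦ Subtype.ext (Subtype.ext ?_)⟩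
    have key : ∀ m : charModule (∅ : Set (PadicAlgCl p)) θ,
        absGaloisRestrict K (v.adicCompletion K) σ • m = m → m = 0 := by
      intro m hm
      have h1 := congrArg (charModuleEquiv θ) hm
      rw [charModuleEquiv_galois_smul] at h1
      have h2 : ((u : ℤ_[p]) - 1) • charModuleEquiv θ m = 0 := by
        rw [sub_smul, one_smul, hu, h1, sub_self]
      have h3 : charModuleEquiv θ m = 0 := hunit.smul_eq_zero.mp h2
      exact (charModuleEquiv θ).injective (by rw [h3, map_zero])
    rw [key _ (a.2 σ hσI), key _ (b.2 σ hσI)]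
  -- hence `#H¹[p] ≤ 1`
  haveI := hfin
  have hcard : Nat.card ((discreteH1 (inertiaIn H v) (charModule (∅ : Set (PadicAlgCl p)) θ))[(p : ℤ)]) ≤ 1 :=
    hle.trans (Finite.card_le_one_iff_subsingleton.mpr hsub)
  have hss := Finite.card_le_one_iff_subsingleton.mp hcard
  have hy' : y ∈ (discreteH1 (inertiaIn H v) (charModule (∅ : Set (PadicAlgCl p)) θ))[(p : ℤ)] :=
    AddSubgroup.torsionBy.nsmul_iff.2 hy
  have := hss.elim ⟨y, hy'⟩ ⟨0, AddSubgroup.zero_mem _⟩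
  exact congrArg Subtype.val this

end CharModule


end Summit.BirchSwinnertonDyer.BirchSwinnertonDyer.Theorems.CharLocalInertiaBounds

end
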